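import Mathlib
import HarnessLib
import Summits.QuantumFields.YangMills.Theorems.LangevinControlUVFemtoCurvatureTwoPointAxisProfileAntitone
import Summits.QuantumFields.YangMills.Theorems.LangevinControlUVFemtoCurvatureTwoPointPlaqReflectCauchySchwarz

/-!
# Route `LangevinControlUV`, crux `FemtoCurvatureTwoPointC` (stmt-QuantumFields-16204), line `Sketch`, reshape v6 —
# the LONGITUDINAL plaquette-covariance profile is log-convex (reflection-positivity Cauchy–Schwarz)

Registered stub `stub_longLogConvex` of skeleton v6 (`Cruxes/FemtoCurvatureTwoPointC/Lines/Sketch.lean`), landed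
`--supports stmt-QuantumFields-16204`. For every compact `G`, continuous `ρ`, torus `(ℤ/L)⁴` and `β ≥ 0`: `g(c)² ≤ g(c−1)·g(c+1)` for `2 ≤ c ≤ L − 2`, `g(s) = Cov_{L,β}(P_0^{01}, P_{s e₀}^{01})`.

Mechanism (adapted from the tree's TRANSVERSE version `AxisCovNonneg.axisProfile_logConvex`): the
discriminant inequality `Cov(P_{ϑp}, P_{p'})² ≤ Cov(P_{ϑp}, P_p) · Cov(P_{ϑp'}, P_{p'})` of the
reflection-positive form (tree `AxisCovNonneg.cov_plaqReflect_sq_le_even`, `cov_sitePlaqReflect_sq_le`,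
`cov_plaqReflect_sq_le_odd`, valid for TEMPORAL plaquettes) applied to the temporal axis plaquettes
`p = (a e₀, (0,1))`, `p' = ((a+1) e₀, (0,1))`: the link / odd-torus mirror `ϑp` sits at `−a e₀`, the
site mirror `ϑ'p` at `−(a+1) e₀`, so the three covariances are the profile at `c`, `c − 1`, `c + 1`
with `c = 2a + 1` (link mirror, even `L`; odd-torus mirror, odd `L`) or `c = 2a + 2` (site mirror,
even `L`); on odd tori an even centre `c` is reached through the odd centre `L − c` and the symmetry
`s ↦ −s` of the profile.
-/

set_option autoImplicit false

noncomputable section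

open MeasureTheory
open Literature.MathematicalPhysics.QuantumFieldTheory

namespace Summit.QuantumFields.YangMills.Theorems.FemtoCurvatureTwoPointC.LongLogConvex

open Summit.QuantumFields.YangMills.Theorems.FemtoCurvatureTwoPoint.AxisCovNonneg

section Helpers

variable {L N : ℕ} [NeZero L] {G : Type*} [Group G] [TopologicalSpace G]
  [IsTopologicalGroup G] [CompactSpace G] [MeasurableSpace G] [BorelSpace G]
  (ρ : G →* Matrix (Fin N) (Fin N) ℂ)

omit [NeZero L] in
/-- Time axis sites: `c e₀ + e₀ = (c + 1) e₀`. [folklore] -/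
theorem shift_single {d : ℕ} (c : ZMod L) :
    Site.shift (Pi.single (0 : Fin (d + 1)) c : Site (d + 1) L) 0 =
      (Pi.single (0 : Fin (d + 1)) (c + 1) : Site (d + 1) L) := by
  rw [Site.shift, ← Pi.single_add]

omit [NeZero L] in
/-- The link / odd-torus plaquette reflection `ϑ` maps the TEMPORAL axis plaquette based at `c e₀`
(plane `q ∋ e₀`) to the temporal axis plaquette based at `(−c) e₀`. [folklore] -/
theorem plaqReflect_single {d : ℕ} (q : {p : Fin (d + 1) × Fin (d + 1) // p.1 < p.2})
    (hq : q.1.1 = 0) (c : ZMod L) :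
    WilsonRP.plaqReflect
        ((((Pi.single (0 : Fin (d + 1)) c : Site (d + 1) L), q)) : Plaquette (d + 1) L) =
      (((Pi.single (0 : Fin (d + 1)) (-c) : Site (d + 1) L), q)) := by
  simp only [WilsonRP.plaqReflect, if_pos hq, shift_single, timeReflect_single]
  congr 2
  ring

omit [NeZero L] in
/-- The site plaquette reflection `ϑ'` maps the temporal axis plaquette based at `c e₀` to the
temporal axis plaquette based at `(−(c + 1)) e₀`. [folklore] -/
theorem sitePlaqReflect_single {d : ℕ} (q : {p : Fin (d + 1) × Fin (d + 1) // p.1 < p.2})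
    (hq : q.1.1 = 0) (c : ZMod L) :
    WilsonSiteRP.sitePlaqReflect
        ((((Pi.single (0 : Fin (d + 1)) c : Site (d + 1) L), q)) : Plaquette (d + 1) L) =
      (((Pi.single (0 : Fin (d + 1)) (-(c + 1)) : Site (d + 1) L), q)) := by
  simp only [WilsonSiteRP.sitePlaqReflect, if_pos hq, shift_single, negReflect_single]

omit [NeZero L] in
/-- A temporal axis plaquette based at `t e₀` with `1 ≤ t`, `t + 1 ≤ L/2` is positive for the link
reflection. [folklore] -/
theorem isPosPlaq_single {d : ℕ} (q : {p : Fin (d + 1) × Fin (d + 1) // p.1 < p.2})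
    (hq : q.1.1 = 0) {t : ℕ} (ht : t < L) (h1 : 1 ≤ t) (h2 : t + 1 ≤ L / 2) :
    WilsonRP.IsPosPlaq
      ((((Pi.single (0 : Fin (d + 1)) ((t : ℕ) : ZMod L) : Site (d + 1) L), q)) :
        Plaquette (d + 1) L) := by
  simp only [WilsonRP.IsPosPlaq, if_pos hq, val_single_zero ht]
  exact ⟨h1, h2⟩

omit [NeZero L] in
/-- A temporal axis plaquette based at `t e₀` with `t < L/2` is positive for the site reflection.
[folklore] -/
theorem isSitePosPlaq_single {d : ℕ} (q : {p : Fin (d + 1) × Fin (d + 1) // p.1 < p.2})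
    (hq : q.1.1 = 0) {t : ℕ} (ht : t < L) (h2 : t < L / 2) :
    WilsonSiteRP.IsSitePosPlaq
      ((((Pi.single (0 : Fin (d + 1)) ((t : ℕ) : ZMod L) : Site (d + 1) L), q)) :
        Plaquette (d + 1) L) := by
  simp only [WilsonSiteRP.IsSitePosPlaq, if_pos hq, val_single_zero ht]
  exact h2

omit [NeZero L] in
/-- A (temporal or spatial) axis plaquette based at `t e₀` with `1 ≤ t ≤ L/2` is positive for the
odd-torus reflection. [folklore] -/
theorem isOPosPlaq_single {d : ℕ} (q : {p : Fin (d + 1) × Fin (d + 1) // p.1 < p.2})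
    {t : ℕ} (ht : t < L) (h1 : 1 ≤ t) (h2 : t ≤ L / 2) :
    WilsonOddRP.IsOPosPlaq
      ((((Pi.single (0 : Fin (d + 1)) ((t : ℕ) : ZMod L) : Site (d + 1) L), q)) :
        Plaquette (d + 1) L) := by
  simp only [WilsonOddRP.IsOPosPlaq, val_single_zero ht]
  exact ⟨h1, h2⟩

/-- **Log-convexity of the longitudinal profile (reflection-positivity Cauchy–Schwarz).** On the
torus `(ℤ/L)^{d+1}`, for every compact `G`, continuous `ρ`, `β ≥ 0`, TEMPORAL plane `q ∋ e₀` and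
`2 ≤ c ≤ L − 2`: `f(c)² ≤ f(c−1) f(c+1)` for the profile `f(s) = Cov(P_0^q, P_{s e₀}^q)` (indices
mod `L`). Even `L`: link mirror (odd `c`) / site mirror (even `c`) of the temporal pair at times
`a, a + 1`; odd `L`: odd-torus mirror at `c` (odd `c`) or at `L − c` (even `c`). [folklore] -/
theorem longProfile_logConvex {d : ℕ} (hρ : Continuous ρ) {β : ℝ} (hβ : 0 ≤ β)
    (q : {p : Fin (d + 1) × Fin (d + 1) // p.1 < p.2}) (hq : q.1.1 = 0) (f : ℕ → ℝ)
    (hf : f = fun s => wilsonExpectation ρ β (fun U : GaugeConfig (d + 1) L G =>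
        WilsonRP.plaqRe ρ U ((0 : Site (d + 1) L), q) *
          WilsonRP.plaqRe ρ U ((Pi.single (0 : Fin (d + 1)) ((s : ℕ) : ZMod L) : Site (d + 1) L), q))
      - wilsonExpectation ρ β (fun U : GaugeConfig (d + 1) L G =>
          WilsonRP.plaqRe ρ U ((0 : Site (d + 1) L), q))
        * wilsonExpectation ρ β (fun U : GaugeConfig (d + 1) L G =>
          WilsonRP.plaqRe ρ U ((Pi.single (0 : Fin (d + 1)) ((s : ℕ) : ZMod L) : Site (d + 1) L), q)))
    {c : ℕ} (hc2 : 2 ≤ c) (hcL : c + 2 ≤ L) : f c ^ 2 ≤ f (c - 1) * f (c + 1) := by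
  -- covariance of a pair `(single 0 c, single 0 c')` in terms of `f` (adapted from the tree's
  -- `AxisCovNonneg.axisProfile_logConvex`)
  have hpair : ∀ (c c' : ZMod L) (m : ℕ), (c' - c = (m : ZMod L) ∨ c' - c = -(m : ZMod L)) →
      wilsonExpectation ρ β (fun U : GaugeConfig (d + 1) L G =>
          WilsonRP.plaqRe ρ U ((Pi.single (0 : Fin (d + 1)) c : Site (d + 1) L), q) *
            WilsonRP.plaqRe ρ U ((Pi.single (0 : Fin (d + 1)) c' : Site (d + 1) L), q))
        - wilsonExpectation ρ β (fun U : GaugeConfig (d + 1) L G =>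
            WilsonRP.plaqRe ρ U ((Pi.single (0 : Fin (d + 1)) c : Site (d + 1) L), q))
          * wilsonExpectation ρ β (fun U : GaugeConfig (d + 1) L G =>
            WilsonRP.plaqRe ρ U ((Pi.single (0 : Fin (d + 1)) c' : Site (d + 1) L), q)) = f m := by
    intro c c' m hm
    rw [hf]
    refine cov_pair_eq_origin ρ β q ?_
    rcases hm with hm | hm
    · left; rw [← Pi.single_sub, hm]
    · right; rw [← Pi.single_sub, hm, Pi.single_neg]
  -- the centre `c` is `2a + 1` or `2a + 2`
  obtain ⟨a, ha⟩ : ∃ a, c = 2 * a + 1 ∨ c = 2 * a + 2 := ⟨(c - 1) / 2, by omega⟩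
  have haL : a < L := by omega
  have ha1L : a + 1 < L := by omega
  rcases Nat.even_or_odd L with hL | hL
  · -- even torus `L = r + r`
    obtain ⟨r, hr⟩ := hL
    rcases ha with rfl | rfl
    · -- odd centre `c = 2a + 1`, `a ≥ 1`: link mirror of the temporal pair at times `a`, `a + 1`
      have h := cov_plaqReflect_sq_le_even ρ ⟨r, hr⟩ hρ hβ
        (isPosPlaq_single (L := L) q hq haL (by omega) (by omega))
        (isPosPlaq_single (L := L) q hq ha1L (by omega) (by omega))
      simp only [plaqReflect_single q hq] at h
      rw [hpair _ _ (2 * a + 1) (Or.inl (by push_cast; ring)),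
        hpair _ _ (2 * a) (Or.inl (by push_cast; ring)),
        hpair _ _ (2 * a + 1 + 1) (Or.inl (by push_cast; ring))] at h
      rw [Nat.add_sub_cancel]
      exact h
    · -- even centre `c = 2a + 2`: site mirror of the temporal pair at times `a`, `a + 1`
      have h := cov_sitePlaqReflect_sq_le ρ ⟨r, hr⟩ hρ β
        (Or.inl (isSitePosPlaq_single (L := L) q hq haL (by omega)))
        (Or.inl (isSitePosPlaq_single (L := L) q hq ha1L (by omega)))
      simp only [sitePlaqReflect_single q hq] at h
      rw [hpair _ _ (2 * a + 2) (Or.inl (by push_cast; ring)),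
        hpair _ _ (2 * a + 1) (Or.inl (by push_cast; ring)),
        hpair _ _ (2 * a + 2 + 1) (Or.inl (by push_cast; ring))] at h
      rw [show 2 * a + 2 - 1 = 2 * a + 1 by omega]
      exact h
  · -- odd torus `L = 2r + 1 ≥ 5`
    obtain ⟨r, hr⟩ := hL
    have hL3 : 3 ≤ L := by omega
    rcases ha with rfl | rfl
    · -- odd centre `c = 2a + 1`, `a ≥ 1`: odd-torus mirror of the temporal pair at `a`, `a + 1`
      have h := cov_plaqReflect_sq_le_odd ρ ⟨r, hr⟩ hL3 hρ hβ
        (Or.inl (isOPosPlaq_single (L := L) q haL (by omega) (by omega)))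
        (Or.inl (isOPosPlaq_single (L := L) q ha1L (by omega) (by omega)))
      simp only [plaqReflect_single q hq] at h
      rw [hpair _ _ (2 * a + 1) (Or.inl (by push_cast; ring)),
        hpair _ _ (2 * a) (Or.inl (by push_cast; ring)),
        hpair _ _ (2 * a + 1 + 1) (Or.inl (by push_cast; ring))] at h
      rw [Nat.add_sub_cancel]
      exact h
    · -- even centre `c = 2a + 2 ≤ L − 3`: odd-torus mirror at the odd centre `L − c = 2b + 1`,
      -- temporal pair at times `b`, `b + 1` with `r = a + b + 1`
      obtain ⟨b, rfl⟩ : ∃ b, r = a + b + 1 := ⟨r - a - 1, by omega⟩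
      have hbL : b < L := by omega
      have hb1L : b + 1 < L := by omega
      have h := cov_plaqReflect_sq_le_odd ρ ⟨a + b + 1, hr⟩ hL3 hρ hβ
        (Or.inl (isOPosPlaq_single (L := L) q hbL (by omega) (by omega)))
        (Or.inl (isOPosPlaq_single (L := L) q hb1L (by omega) (by omega)))
      simp only [plaqReflect_single q hq] at h
      have hL' : ((2 * (a + b + 1) + 1 : ℕ) : ZMod L) = 0 := by rw [← hr]; exact ZMod.natCast_self L
      push_cast at hL'
      rw [hpair _ _ (2 * a + 2) (Or.inr (by push_cast; linear_combination hL')),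
        hpair _ _ (2 * a + 2 + 1) (Or.inr (by push_cast; linear_combination hL')),
        hpair _ _ (2 * a + 1) (Or.inr (by push_cast; linear_combination hL'))] at h
      rw [show 2 * a + 2 - 1 = 2 * a + 1 by omega]
      exact h.trans_eq (mul_comm _ _)

/-- **The crux's longitudinal pair in `plaqRe` coordinates** (`Cov(N − A, N − B) = Cov(A, B)`):
`Cov_{L,β}(P_0^{01}, P_{n e₀}^{01}) = Cov_{L,β}(Re tr ρ(U_{p(0;0,1)}), Re tr ρ(U_{p(n e₀;0,1)}))`.
[folklore] -/
theorem cruxLongCov_eq (hρ : Continuous ρ) (β : ℝ) (n : ℕ) :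
    wilsonExpectation ρ β (fun U : GaugeConfig 4 L G =>
          ((N : ℝ) - (ρ (plaquetteHolonomy U 0 0 1)).trace.re) *
            ((N : ℝ) - (ρ (plaquetteHolonomy U
              (Pi.single (0 : Fin 4) ((n : ℕ) : ZMod L)) 0 1)).trace.re))
        - wilsonExpectation ρ β (fun U : GaugeConfig 4 L G =>
            (N : ℝ) - (ρ (plaquetteHolonomy U 0 0 1)).trace.re)
          * wilsonExpectation ρ β (fun U : GaugeConfig 4 L G =>
            (N : ℝ) - (ρ (plaquetteHolonomy U
              (Pi.single (0 : Fin 4) ((n : ℕ) : ZMod L)) 0 1)).trace.re) =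
    wilsonExpectation ρ β (fun U : GaugeConfig 4 L G =>
        WilsonRP.plaqRe ρ U ((0 : Site 4 L), ⟨((0 : Fin 4), (1 : Fin 4)), by decide⟩) *
          WilsonRP.plaqRe ρ U ((Pi.single (0 : Fin 4) ((n : ℕ) : ZMod L) : Site 4 L),
            ⟨((0 : Fin 4), (1 : Fin 4)), by decide⟩))
      - wilsonExpectation ρ β (fun U : GaugeConfig 4 L G =>
          WilsonRP.plaqRe ρ U ((0 : Site 4 L), ⟨((0 : Fin 4), (1 : Fin 4)), by decide⟩))
        * wilsonExpectation ρ β (fun U : GaugeConfig 4 L G =>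
          WilsonRP.plaqRe ρ U ((Pi.single (0 : Fin 4) ((n : ℕ) : ZMod L) : Site 4 L),
            ⟨((0 : Fin 4), (1 : Fin 4)), by decide⟩)) := by
  haveI := isProbabilityMeasure_wilsonMeasure (d := 4) (L := L) ρ hρ β
  set q01 : {p : Fin 4 × Fin 4 // p.1 < p.2} := ⟨((0 : Fin 4), (1 : Fin 4)), by decide⟩ with hq01
  have hA : ∀ U : GaugeConfig 4 L G, (ρ (plaquetteHolonomy U 0 0 1)).trace.re =
      WilsonRP.plaqRe ρ U ((0 : Site 4 L), q01) := fun U => rfl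
  have hB : ∀ U : GaugeConfig 4 L G,
      (ρ (plaquetteHolonomy U (Pi.single (0 : Fin 4) ((n : ℕ) : ZMod L)) 0 1)).trace.re =
        WilsonRP.plaqRe ρ U ((Pi.single (0 : Fin 4) ((n : ℕ) : ZMod L) : Site 4 L), q01) :=
    fun U => rfl
  simp only [hA, hB]
  have hmA := WilsonRP.measurable_plaqRe ρ hρ (((0 : Site 4 L), q01) : Plaquette 4 L)
  have hmB := WilsonRP.measurable_plaqRe ρ hρ
    (((Pi.single (0 : Fin 4) ((n : ℕ) : ZMod L) : Site 4 L), q01) : Plaquette 4 L)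
  have step1 := cov_const_sub (wilsonMeasure (d := 4) (L := L) ρ β) hmA hmB
    ⟨N, fun U => WilsonRP.abs_plaqRe_le ρ hρ U _⟩ ⟨N, fun U => WilsonRP.abs_plaqRe_le ρ hρ U _⟩ (N : ℝ)
  simp only [wilsonExpectation]
  exact step1

end Helpers

end Summit.QuantumFields.YangMills.Theorems.FemtoCurvatureTwoPointC.LongLogConvex

namespace Summit.QuantumFields.YangMills.Theorems.FemtoCurvatureTwoPointC

/-- **Registered stub `stub_longLogConvex`** (line `Sketch`, skeleton v6, `--supports stmt-QuantumFields-16204`): the LONGITUDINAL plaquette-covariance profile is log-convex (reflection-positivity Cauchy–Schwarz). For every compact `G`, continuous `ρ`, torus `(ℤ/L)⁴` and `β ≥ 0`: `g(c)² ≤ g(c−1)·g(c+1)` for `2 ≤ c ≤ L − 2`, `g(s) = Cov_{L,β}(P_0^{01}, P_{s e₀}^{01})`. [folklore] -/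
theorem stub_longLogConvex :
    ∀ (L N : ℕ) [NeZero L] (G : Type) [Group G] [TopologicalSpace G] [IsTopologicalGroup G] [CompactSpace G] [MeasurableSpace G] [BorelSpace G] (ρ : G →* Matrix (Fin N) (Fin N) ℂ), Continuous ρ → ∀ (β : ℝ), 0 ≤ β → ∀ (g : ℕ → ℝ), (g = fun s : ℕ => wilsonExpectation ρ β (fun U : GaugeConfig 4 L G => ((N : ℝ) - (ρ (plaquetteHolonomy U 0 0 1)).trace.re) * ((N : ℝ) - (ρ (plaquetteHolonomy U (Pi.single (0 : Fin 4) ((s : ℕ) : ZMod L)) 0 1)).trace.re)) - wilsonExpectation ρ β (fun U : GaugeConfig 4 L G => (N : ℝ) - (ρ (plaquetteHolonomy U 0 0 1)).trace.re) * wilsonExpectation ρ β (fun U : GaugeConfig 4 L G => (N : ℝ) - (ρ (plaquetteHolonomy U (Pi.single (0 : Fin 4) ((s : ℕ) : ZMod L)) 0 1)).trace.re)) → ∀ (c : ℕ), 2 ≤ c → c + 2 ≤ L → g c ^ 2 ≤ g (c - 1) * g (c + 1) := by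
  intro L N _ G _ _ _ _ _ _ ρ hρ β hβ g hg c hc2 hcL
  refine LongLogConvex.longProfile_logConvex (L := L) (d := 3) ρ hρ hβ
    ⟨((0 : Fin 4), (1 : Fin 4)), by decide⟩ rfl g ?_ hc2 hcL
  rw [hg]
  funext s
  exact LongLogConvex.cruxLongCov_eq ρ hρ β s

end Summit.QuantumFields.YangMills.Theorems.FemtoCurvatureTwoPointC

end
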